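import Literature.Analysis.OperatorTheory.Enflo2023.EndToEnd
import Literature.Analysis.OperatorTheory.Enflo2023.ClaimAudit
import HarnessLib

/-!
# Enflo 2023, v2 pp.17–20: the RUN-RESTRICTED residual of Part B (`ClaimRun`), and Part A made load-bearing

Source under adjudication: Per H. Enflo, *On the invariant subspace problem in Hilbert spaces*, arXiv:2305.15442
(v1 2023, v2 2024), bib key `Enflo2023` — a CLAIMED proof of the invariant subspace problem for operators on a
separable Hilbert space (claimed result under adjudication).  b2b-enflo repair cell, formaliser 2 (Part B:
(28)–(47), the limiting argument and the final deduction; BLOCK-2b).  NOTHING here asserts the manuscript's theorem: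
every theorem below that concludes `HasNontrivialClosedInvariantSubspace T` (or `Referee.ISP_separable`) carries the
manuscript's remaining claim as an explicit HYPOTHESIS (`MCStep.ClaimG`, `MCStep.ClaimRun`, the step oracle of a
`MCStep.StepSystem`, or `EndToEnd.PartBResidualRun`), and no declaration proves that hypothesis.

## Why this file (referee gen-19/20, census R-V15, ∀-side)

`MCStep.Claim T x₀ S C β G` (module `MCStep`) asks for ONE MORE Main-Construction step from EVERY pivot state and
EVERY state in its epoch invariant `InvP` — uniformly over all true MC states of `T`.  Two consequences recorded by
the referee (REFEREE §27.3 D34, §28): (i) the manuscript needs its step only along THE run it builds (tex L651 "use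
MC to get down to arbitrarily small `(εθ)`'s without changing `⟨[ ]⁻¹x₀, x₀⟩` more than a total of `10(εθ)₀`",
L662–L683 "We use MC with this restriction until `n = n₁'` … then we put in another restriction"), so the typed
residual is over-uniform on the hypothesis side;
(ii) in that typing Part A is REDUNDANT (`MCStep.nis_of_claim`: a start state always exists, the minimal move of
`y = x₀` at radius `0.7`), whereas in the text Part A is what supplies the start vector `y₁'` with small `(εθ)` and
the control (33) that (40)/(43) consume.  This file types the run-restricted residual and re-proves the endgame for
it:

* `MCStep.ClaimG T x₀ S C β G Good` — the step claim RESTRICTED to a class `Good` of states (pivots and states are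
  taken from `Good`, and the step must land in `Good`); `claimG_top_iff`: with `Good = ⊤` it is `MCStep.Claim`.
* `MCStep.StepSystem` — the ABSTRACT partial step system the re-pivoting recursion of `MCStep.Setting` actually
  consumes (certified states `σ` with `v`, `e = (εθ) ≥ 0`, a side vector `w P ≠ 0` within angle `G(e P)` ((40)),
  a step from every state in a pivot's epoch invariant with (b'), (46), (45), a start state; NO operator), its
  adaptive re-pivoting trajectory (`traj`, `vt`, `et`, pivot times `pt`, epoch vectors `wt`, summable rooms) and
  `StepSystem.nis`: the window, (9) and (16) along the certified states for an operator `T` ⟹ `T` has a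
  non-trivial closed invariant subspace (`Eq45.hasNontrivialClosedInvariantSubspace_of_repivoting_C`) — the
  operator enters the endgame ONLY through (9) along the run.  `MCStep.systemOfClaimG` / `MCStep.nis_of_claimG`:
  the restricted claim `ClaimG … Good` and ONE `Good` start state form a step system on the `Good` states, hence
  give a non-trivial closed invariant subspace (kernel, standard axioms; `MCStep.Setting` is the instance
  `Good = ⊤`, not re-derived).
* `MCStep.ReachN C β N s₀` — the states REACHABLE from `s₀` by admissible steps (ratio (b') and drift (45)) that
  maintain an invariant `N`; `MCStep.ClaimRun T x₀ S C β G N s₀` — the claim asked ONLY at reachable pivots and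
  reachable states: "THE run from `s₀` can always be continued by one more step keeping `N`".
  `nis_of_claimRun`: `ClaimRun … N s₀ ⟹` a non-trivial closed invariant subspace.  `claimRun_top_of_claim`:
  `Claim ⟹ ClaimRun … ⊤ s₀` for every `s₀` — the run-restricted residual with no invariant is WEAKER than `Claim`,
  so `nis_of_claimRun` STRENGTHENS `MCStep.hasNontrivialClosedInvariantSubspace_of_claim`.  Run-level facts every
  state the residual quantifies over satisfies: `ReachN.etheta_le` (`(εθ) ≤ (εθ)₀`), `ReachN.abs_re_inner_le`
  (`|Re⟨x₀, v − v₀⟩| ≤ C((εθ)₀ − (εθ))`), `ReachN.inv` (`N` holds, given `N s₀`).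
* `EndToEnd.Ctrl33 T hT u₀ E₀` — the START-QUALITY invariant ((33)-control): the state is the state of an
  admissible vector `y` (`V = V_y`, `y ∈ Adm u₀`) at a level `t ∈ (0, E₀]` with `(εθ) ≤ 3γ(t)^{1/2}` (Lemma 3 = 5)
  and the start control (33) in the kernel form Part A hands off (`EndToEnd.exists_state_of_partA`:
  `1 − γ(t) ≤ |a₀|² ≤ 1 − (0.98·10²⁰t¹¹)²`, `(0.98·10²⁰t¹¹)² ≤ Σ_{j≥1}|a_j|² ≤ γ(t)`, `(1 − γ(t))‖a‖² ≤ |a₀|²`,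
  `γ = Lemma2.gammaEps`).  `exists_ctrl33_of_partA`: Part A's exit state HAS start quality (this consumes
  `Lemma2.lemma3_etheta`, so far unused downstream).  `EndToEnd.nis_of_partA_and_claimRun`: Part A's standing
  data at `y₁'` AND the run-restricted residual asked only from start-quality states
  (`∀ s₀, Ctrl33 … s₀ → ClaimRun … (Ctrl33 …) s₀`) ⟹ a non-trivial closed invariant subspace — here Part A is
  LOAD-BEARING: the residual is asked only from states carrying Part A's (33)-control, the start state fed to the
  endgame IS Part A's exit state (not the free start `y = x₀` at radius `0.7` of `MCStep.nis_of_claim`, whose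
  `|a₀|² ≈ 0.09` nothing in the tree certifies as start-quality), and for an operator whose (26)-run never exits
  through Case I the residual is not invoked at all (Part A's first disjunct).  `reach_ctrl33`: every state that
  residual is ever asked about is start-quality with `(εθ) ≤ (εθ)_{s₀}` and accumulated drift
  `≤ C((εθ)_{s₀} − (εθ))`.

* Calibration carried over from `ClaimAudit`: `MCStep.not_claimRun_self_of_C_lt_one` ((B'): from the self-pivot
  start at radius `0.7` the run cannot begin when `C < 1`, for every invariant) and `MCStep.claimRun_top_zero`
  ((C'): `T = 0` satisfies the invariant-free residual at `C = 1`) — typing calibration only.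
* `EndToEnd.PartBResidualRun` (`@[claim … "disputed"]`) packages the (33)-started run-restricted residual over all
  operators of norm `10⁻²⁰` (with Part A's standing data at `y₁'` as part of the disjunction), and
  `EndToEnd.isp_of_partBResidualRun : PartBResidualRun → Referee.ISP_separable` is the end-to-end line in which
  Part A's theorem is used; `PartBResidualRun` and `PartBResidual` are incomparable.
* The WEAKEST sufficient form ("THE run from `s₀` can be built"): `∃ Good ∋ s₀, ClaimG … Good` — SOME class of
  states containing the start on which the restricted claim holds.  `MCStep.exists_claimG_of_claimRun`
  (`ClaimRun … N s₀` gives it; the converse fails in general — the reachability class also contains states reached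
  by admissible steps the class did not choose), `exists_claimG_of_claim`, `nis_of_exists_claimG`;
  `EndToEnd.nis_of_partA_and_exists_claimG` (Part A load-bearing: the class is asked for only at Part A's exit
  state), `EndToEnd.PartBResidualClass` (`@[claim … "disputed"]`), `partBResidualClass_of_partBResidualRun`,
  `EndToEnd.isp_of_partBResidualClass : PartBResidualClass → Referee.ISP_separable`.

The manuscript's support for the residual is unchanged and is NOT formalised here: (34)–(37) (surjectivity of the
first-order map from `s(εθ)`-independence), (38)–(45) in the dependent case, the `w₀₀`-restriction (46), and the
first-order idealisation (rows B4, B8–B13, B35; GAP.md §F2).  "Lean refuses" exactly at `ClaimRun … (Ctrl33 …) s₀` /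
`∃ Good ∋ s₀, ClaimG … Good` for a start-quality `s₀`.
[cite: Enflo2023, v2 p.17 l.578–583; (40) p.18; (44)–(46) p.19; p.20 l.660–683; p.13 (26); p.15 (33); p.22 (11)]
No new axioms; closure `[propext, Classical.choice, Quot.sound]`.  Origin: planner-b2b-enflo-2-g10-0 (F2 gen-10),
2026-08-19.
-/

noncomputable section

open scoped InnerProductSpace ComplexConjugate
open Filter Topology RCLike

namespace Literature.Analysis.OperatorTheory.Enflo2023

namespace MCStep

section Abstract

variable {H : Type*} [NormedAddCommGroup H] [InnerProductSpace ℂ H]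

/-! ### An abstract partial step system and its adaptive re-pivoting run -/

/-- **Abstract step system of the endgame** (what the re-pivoting recursion of `MCStep.Setting` actually consumes,
made a structure so that RESTRICTED claims can feed it): a type `σ` of certified states with MC vectors `v s` and
values `e s = (εθ)_s ≥ 0`; the constants `C ≥ 0`, `0 < β ≤ 1` and the angle modulus `G ≥ 0`, `G(E) → 0⁺`; at every
state `P` (as a pivot) a side-condition vector `w P ≠ 0` within angle `G(e P)` of `x₀ − v P` ((40)); and from every
state `s` in `P`'s epoch invariant (`e s ≤ e P`, `⟨w P, v s − v P⟩ = 0`, `|Re⟨x₀, v s − v P⟩| ≤ C(e P − e s)`) a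
NEXT state with (b') `e ≤ (1−β)e s`, (46) `⟨w P, v' − v s⟩ = 0`, (45) `|Re⟨x₀, v' − v s⟩| ≤ Cβ·e s`; and a start
state.  The operator enters only later, through (9) along the states (`StepSystem.nis`).
[cite: Enflo2023, v2 p.17 l.578–583, (40) p.18, (45)–(46) p.19, p.20] -/
structure StepSystem (H : Type*) [NormedAddCommGroup H] [InnerProductSpace ℂ H] (σ : Type*) where
  /-- the unit vector `x₀` -/
  x₀ : H
  /-- the drift constant of (45) -/
  C : ℝ
  /-- the ratio of (b') -/
  β : ℝ
  /-- the angle modulus of (40) as a function of `(εθ)` -/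
  G : ℝ → ℝ
  /-- the MC vector `[ ]⁻¹x₀` of a certified state -/
  v : σ → H
  /-- the `(εθ)` of a certified state -/
  e : σ → ℝ
  /-- `C ≥ 0` -/
  hC : 0 ≤ C
  /-- `β > 0` -/
  hβ : 0 < β
  /-- `β ≤ 1` -/
  hβ1 : β ≤ 1
  /-- `G ≥ 0` -/
  hG0 : ∀ x, 0 ≤ G x
  /-- `G(E) → 0` as `E → 0⁺` -/
  hG : ∀ η : ℝ, 0 < η → ∃ δ : ℝ, 0 < δ ∧ ∀ x, 0 ≤ x → x ≤ δ → G x ≤ η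
  /-- `(εθ) ≥ 0` -/
  e_nonneg : ∀ s, 0 ≤ e s
  /-- the side-condition vector (`w₀₀`) at a pivot -/
  w : σ → H
  /-- it is non-zero -/
  w_ne_zero : ∀ P, w P ≠ 0
  /-- (40): its angle to the moved vector is at most `G((εθ)_P)` -/
  w_angle : ∀ P, ‖((‖x₀ - v P‖ : ℝ) : ℂ) • w P - ((‖w P‖ : ℝ) : ℂ) • (x₀ - v P)‖ ≤ G (e P) * (‖w P‖ * ‖x₀ - v P‖)
  /-- the step from a state in a pivot's epoch invariant -/
  next : ∀ P s : σ,
    (e s ≤ e P ∧ ⟪w P, v s - v P⟫_ℂ = 0 ∧ |re ⟪x₀, v s - v P⟫_ℂ| ≤ C * (e P - e s)) → σ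
  /-- (b') at the step -/
  next_ratio : ∀ (P s : σ) (h : e s ≤ e P ∧ ⟪w P, v s - v P⟫_ℂ = 0 ∧ |re ⟪x₀, v s - v P⟫_ℂ| ≤ C * (e P - e s)),
    e (next P s h) ≤ (1 - β) * e s
  /-- (46) at the step -/
  next_side : ∀ (P s : σ) (h : e s ≤ e P ∧ ⟪w P, v s - v P⟫_ℂ = 0 ∧ |re ⟪x₀, v s - v P⟫_ℂ| ≤ C * (e P - e s)),
    ⟪w P, v (next P s h) - v s⟫_ℂ = 0
  /-- (45) at the step -/
  next_drift : ∀ (P s : σ) (h : e s ≤ e P ∧ ⟪w P, v s - v P⟫_ℂ = 0 ∧ |re ⟪x₀, v s - v P⟫_ℂ| ≤ C * (e P - e s)),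
    |re ⟪x₀, v (next P s h) - v s⟫_ℂ| ≤ C * β * e s
  /-- the start state -/
  s₀ : σ

namespace StepSystem

variable {σ : Type*} (𝔖 : StepSystem H σ)

/-- The epoch invariant of pivot `P` at state `s` ((45), (46) and (b') accumulated). [cite: Enflo2023, v2 (45)–(46), p.19] -/
abbrev Inv (P s : σ) : Prop :=
  𝔖.e s ≤ 𝔖.e P ∧ ⟪𝔖.w P, 𝔖.v s - 𝔖.v P⟫_ℂ = 0 ∧ |re ⟪𝔖.x₀, 𝔖.v s - 𝔖.v P⟫_ℂ| ≤ 𝔖.C * (𝔖.e P - 𝔖.e s)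

/-- A pivot is in its own epoch invariant. [cite: Enflo2023, v2 p.19] -/
lemma inv_self (P : σ) : 𝔖.Inv P P := by
  refine ⟨le_rfl, ?_, ?_⟩
  · simp
  · simp

/-- The epoch invariant is preserved by a step. [cite: Enflo2023, v2 (45)–(46), p.19] -/
lemma inv_next (P s : σ) (h : 𝔖.Inv P s) : 𝔖.Inv P (𝔖.next P s h) := by
  have hE := h.1
  have hc := h.2.1
  have hd := h.2.2
  have hr := 𝔖.next_ratio P s h
  have hcs := 𝔖.next_side P s h
  have hds := 𝔖.next_drift P s h
  have hEs : 0 ≤ 𝔖.e s := 𝔖.e_nonneg s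
  have hsplit : 𝔖.v (𝔖.next P s h) - 𝔖.v P = (𝔖.v (𝔖.next P s h) - 𝔖.v s) + (𝔖.v s - 𝔖.v P) := by abel
  refine ⟨?_, ?_, ?_⟩
  · have : 0 ≤ 𝔖.β * 𝔖.e s := mul_nonneg 𝔖.hβ.le hEs
    linarith
  · rw [hsplit, inner_add_right, hcs, hc, add_zero]
  · rw [hsplit, inner_add_right, map_add]
    have h1 := abs_add_le (re ⟪𝔖.x₀, 𝔖.v (𝔖.next P s h) - 𝔖.v s⟫_ℂ) (re ⟪𝔖.x₀, 𝔖.v s - 𝔖.v P⟫_ℂ)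
    have h2 : 𝔖.C * 𝔖.β * 𝔖.e s ≤ 𝔖.C * (𝔖.e s - 𝔖.e (𝔖.next P s h)) := by
      have : 𝔖.β * 𝔖.e s ≤ 𝔖.e s - 𝔖.e (𝔖.next P s h) := by linarith
      calc 𝔖.C * 𝔖.β * 𝔖.e s = 𝔖.C * (𝔖.β * 𝔖.e s) := by ring
        _ ≤ 𝔖.C * (𝔖.e s - 𝔖.e (𝔖.next P s h)) := mul_le_mul_of_nonneg_left this 𝔖.hC
    linarith

/-- The state of the run recursion: current pivot, current state in its epoch invariant, epoch index. [cite: Enflo2023, v2 p.19–20] -/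
structure RunSt where
  /-- current pivot -/
  P : σ
  /-- current state -/
  s : σ
  /-- number of re-pivots so far -/
  i : ℕ
  /-- the epoch invariant -/
  h : 𝔖.Inv P s

/-- The ADAPTIVE re-pivoting rule: re-pivot as soon as the room modulus `2G(e) + √((1+C)e)` is below `2^{-j}`. [cite: Enflo2023, v2 p.20] -/
def room (s : σ) (j : ℕ) : Prop :=
  2 * 𝔖.G (𝔖.e s) + Real.sqrt ((1 + 𝔖.C) * 𝔖.e s) ≤ (1 / 2 : ℝ) ^ j

/-- The step taken from a run state. [cite: Enflo2023, v2 p.19] -/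
def adv (r : 𝔖.RunSt) : σ := 𝔖.next r.P r.s r.h

open Classical in
/-- One step of the run: advance; re-pivot there if the room threshold of the next epoch is met. [cite: Enflo2023, v2 p.19–20] -/
def succ (r : 𝔖.RunSt) : 𝔖.RunSt :=
  if 𝔖.room (𝔖.adv r) (r.i + 1) then ⟨𝔖.adv r, 𝔖.adv r, r.i + 1, 𝔖.inv_self _⟩
  else ⟨r.P, 𝔖.adv r, r.i, 𝔖.inv_next r.P r.s r.h⟩

/-- The trajectory: start at `s₀` as pivot `0`, iterate `succ`. [cite: Enflo2023, v2 p.19–20] -/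
def traj : ℕ → 𝔖.RunSt
  | 0 => ⟨𝔖.s₀, 𝔖.s₀, 0, 𝔖.inv_self _⟩
  | k + 1 => 𝔖.succ (traj k)

/-- The MC vectors along the trajectory. [cite: Enflo2023, v2 p.19] -/
def vt (k : ℕ) : H := 𝔖.v (𝔖.traj k).s

/-- The `(εθ)` along the trajectory. [cite: Enflo2023, v2 p.19] -/
def et (k : ℕ) : ℝ := 𝔖.e (𝔖.traj k).s

/-- The epoch index along the trajectory. [cite: Enflo2023, v2 p.20] -/
def ep (k : ℕ) : ℕ := (𝔖.traj k).i

/-- Unfolding `succ` when the threshold is met. [folklore] -/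
lemma succ_eq_of_room (r : 𝔖.RunSt) (h : 𝔖.room (𝔖.adv r) (r.i + 1)) :
    𝔖.succ r = ⟨𝔖.adv r, 𝔖.adv r, r.i + 1, 𝔖.inv_self _⟩ := by
  unfold succ; rw [if_pos h]

/-- Unfolding `succ` when the threshold is not met. [folklore] -/
lemma succ_eq_of_not_room (r : 𝔖.RunSt) (h : ¬ 𝔖.room (𝔖.adv r) (r.i + 1)) :
    𝔖.succ r = ⟨r.P, 𝔖.adv r, r.i, 𝔖.inv_next r.P r.s r.h⟩ := by
  unfold succ; rw [if_neg h]

/-- `traj (k+1) = succ (traj k)`. [folklore] -/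
lemma traj_succ (k : ℕ) : 𝔖.traj (k + 1) = 𝔖.succ (𝔖.traj k) := rfl

/-- The state component always advances by the step. [folklore] -/
lemma traj_succ_s (k : ℕ) : (𝔖.traj (k + 1)).s = 𝔖.adv (𝔖.traj k) := by
  by_cases h : 𝔖.room (𝔖.adv (𝔖.traj k)) ((𝔖.traj k).i + 1)
  · rw [traj_succ, 𝔖.succ_eq_of_room _ h]
  · rw [traj_succ, 𝔖.succ_eq_of_not_room _ h]

/-- The two cases of a step: re-pivot (index up, pivot := new state, threshold met) or not (index and pivot kept). [folklore] -/
lemma traj_cases (k : ℕ) :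
    (𝔖.room (𝔖.traj (k + 1)).s (𝔖.ep k + 1) ∧ 𝔖.ep (k + 1) = 𝔖.ep k + 1 ∧
        (𝔖.traj (k + 1)).P = (𝔖.traj (k + 1)).s) ∨
    (¬ 𝔖.room (𝔖.traj (k + 1)).s (𝔖.ep k + 1) ∧ 𝔖.ep (k + 1) = 𝔖.ep k ∧
        (𝔖.traj (k + 1)).P = (𝔖.traj k).P) := by
  by_cases h : 𝔖.room (𝔖.adv (𝔖.traj k)) ((𝔖.traj k).i + 1)
  · left
    have e := 𝔖.succ_eq_of_room _ h
    refine ⟨?_, ?_, ?_⟩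
    · rw [traj_succ_s]; exact h
    · show (𝔖.traj (k + 1)).i = (𝔖.traj k).i + 1
      rw [traj_succ, e]
    · rw [traj_succ, e]
  · right
    have e := 𝔖.succ_eq_of_not_room _ h
    refine ⟨?_, ?_, ?_⟩
    · rw [traj_succ_s]; exact h
    · show (𝔖.traj (k + 1)).i = (𝔖.traj k).i
      rw [traj_succ, e]
    · rw [traj_succ, e]

/-- `ep 0 = 0`. [folklore] -/
lemma ep_zero : 𝔖.ep 0 = 0 := rfl

/-- (b') along the trajectory. [cite: Enflo2023, v2 (b'), p.17] -/
lemma et_succ_le (k : ℕ) : 𝔖.et (k + 1) ≤ (1 - 𝔖.β) * 𝔖.et k := by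
  show 𝔖.e (𝔖.traj (k + 1)).s ≤ (1 - 𝔖.β) * 𝔖.e (𝔖.traj k).s
  rw [traj_succ_s]; exact 𝔖.next_ratio _ _ _

/-- (45) along the trajectory. [cite: Enflo2023, v2 (45), p.19] -/
lemma drift_succ (k : ℕ) : |re ⟪𝔖.x₀, 𝔖.vt (k + 1) - 𝔖.vt k⟫_ℂ| ≤ 𝔖.C * 𝔖.β * 𝔖.et k := by
  show |re ⟪𝔖.x₀, 𝔖.v (𝔖.traj (k + 1)).s - 𝔖.v (𝔖.traj k).s⟫_ℂ| ≤ 𝔖.C * 𝔖.β * 𝔖.e (𝔖.traj k).s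
  rw [traj_succ_s]; exact 𝔖.next_drift _ _ _

/-- (46) along the trajectory, with the CURRENT pivot's side-condition vector. [cite: Enflo2023, v2 (46), p.19] -/
lemma side_succ (k : ℕ) : ⟪𝔖.w (𝔖.traj k).P, 𝔖.vt (k + 1) - 𝔖.vt k⟫_ℂ = 0 := by
  show ⟪𝔖.w (𝔖.traj k).P, 𝔖.v (𝔖.traj (k + 1)).s - 𝔖.v (𝔖.traj k).s⟫_ℂ = 0
  rw [traj_succ_s]; exact 𝔖.next_side _ _ _

/-- `(εθ)_k ≥ 0`. [cite: Enflo2023, v2 (8), p.4] -/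
lemma et_nonneg (k : ℕ) : 0 ≤ 𝔖.et k := 𝔖.e_nonneg _

/-- Geometric decay `(εθ)_k ≤ (1−β)^k (εθ)_0`. [cite: Enflo2023, v2 (b'), p.17] -/
lemma et_le_pow (k : ℕ) : 𝔖.et k ≤ (1 - 𝔖.β) ^ k * 𝔖.et 0 := by
  induction k with
  | zero => simp
  | succ k ih =>
    have hb : 0 ≤ 1 - 𝔖.β := by linarith [𝔖.hβ1]
    calc 𝔖.et (k + 1) ≤ (1 - 𝔖.β) * 𝔖.et k := 𝔖.et_succ_le k
      _ ≤ (1 - 𝔖.β) * ((1 - 𝔖.β) ^ k * 𝔖.et 0) := mul_le_mul_of_nonneg_left ih hb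
      _ = (1 - 𝔖.β) ^ (k + 1) * 𝔖.et 0 := by ring

/-- `(εθ)_k → 0`. [cite: Enflo2023, v2 p.19] -/
lemma et_tendsto : Tendsto 𝔖.et atTop (𝓝 0) := by
  have hb0 : 0 ≤ 1 - 𝔖.β := by linarith [𝔖.hβ1]
  have hb1 : 1 - 𝔖.β < 1 := by linarith [𝔖.hβ]
  have hg : Tendsto (fun k => (1 - 𝔖.β) ^ k * 𝔖.et 0) atTop (𝓝 0) := by
    simpa using (tendsto_pow_atTop_nhds_zero_of_lt_one hb0 hb1).mul_const (𝔖.et 0)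
  exact squeeze_zero (fun k => 𝔖.et_nonneg k) (fun k => 𝔖.et_le_pow k) hg

/-- `(εθ)_k` is non-increasing. [cite: Enflo2023, v2 (b'), p.17] -/
lemma et_antitone : Antitone 𝔖.et := antitone_nat_of_succ_le fun k => by
  have h1 := 𝔖.et_succ_le k
  have h2 : 0 ≤ 𝔖.β * 𝔖.et k := mul_nonneg 𝔖.hβ.le (𝔖.et_nonneg k)
  nlinarith

/-- The epoch index moves by `0` or `+1`. [folklore] -/
lemma ep_succ (k : ℕ) : 𝔖.ep (k + 1) = 𝔖.ep k + 1 ∨ 𝔖.ep (k + 1) = 𝔖.ep k := by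
  rcases 𝔖.traj_cases k with ⟨-, h, -⟩ | ⟨-, h, -⟩
  exacts [Or.inl h, Or.inr h]

/-- The epoch index is monotone. [folklore] -/
lemma ep_mono : Monotone 𝔖.ep := monotone_nat_of_le_succ fun k => by
  rcases 𝔖.ep_succ k with h | h <;> omega

/-- Discrete intermediate values: every index value `≤ ep k` is attained at or before `k`. [folklore] -/
lemma exists_ep_eq_of_le {j k : ℕ} (h : j ≤ 𝔖.ep k) : ∃ k' ≤ k, 𝔖.ep k' = j := by
  induction k with
  | zero => exact ⟨0, le_rfl, by have := 𝔖.ep_zero; omega⟩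
  | succ k ih =>
    by_cases hk : j ≤ 𝔖.ep k
    · obtain ⟨k', hk', e⟩ := ih hk
      exact ⟨k', by omega, e⟩
    · refine ⟨k + 1, le_rfl, ?_⟩
      rcases 𝔖.ep_succ k with h' | h' <;> omega

/-- The room threshold of any fixed level is eventually met (`(εθ)_k → 0` and `G → 0⁺`). [cite: Enflo2023, v2 p.20] -/
lemma room_eventually (j : ℕ) : ∀ᶠ k in atTop, 𝔖.room (𝔖.traj k).s j := by
  obtain ⟨δ, hδ, hGδ⟩ := 𝔖.hG ((1 / 2 : ℝ) ^ j / 4) (by positivity)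
  have hC1 : (0 : ℝ) < 1 + 𝔖.C := by linarith [𝔖.hC]
  have hμ : (0 : ℝ) < ((1 / 2 : ℝ) ^ j / 2) ^ 2 / (1 + 𝔖.C) := div_pos (by positivity) hC1
  have h1 : ∀ᶠ k in atTop, 𝔖.et k ≤ δ := 𝔖.et_tendsto.eventually (eventually_le_nhds hδ)
  have h2 : ∀ᶠ k in atTop, 𝔖.et k ≤ ((1 / 2 : ℝ) ^ j / 2) ^ 2 / (1 + 𝔖.C) :=
    𝔖.et_tendsto.eventually (eventually_le_nhds hμ)
  filter_upwards [h1, h2] with k hk1 hk2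
  have hGk : 𝔖.G (𝔖.et k) ≤ (1 / 2 : ℝ) ^ j / 4 := hGδ _ (𝔖.et_nonneg k) hk1
  have hsq : Real.sqrt ((1 + 𝔖.C) * 𝔖.et k) ≤ (1 / 2 : ℝ) ^ j / 2 := by
    have hle : (1 + 𝔖.C) * 𝔖.et k ≤ ((1 / 2 : ℝ) ^ j / 2) ^ 2 := by
      have := (le_div_iff₀ hC1).1 hk2
      linarith
    calc Real.sqrt ((1 + 𝔖.C) * 𝔖.et k) ≤ Real.sqrt (((1 / 2 : ℝ) ^ j / 2) ^ 2) :=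
          Real.sqrt_le_sqrt hle
      _ = (1 / 2 : ℝ) ^ j / 2 := Real.sqrt_sq (by positivity)
  show 2 * 𝔖.G (𝔖.et k) + Real.sqrt ((1 + 𝔖.C) * 𝔖.et k) ≤ (1 / 2 : ℝ) ^ j
  linarith

/-- The epoch index is unbounded: the run re-pivots infinitely often. [cite: Enflo2023, v2 p.20] -/
lemma ep_unbounded (j : ℕ) : ∃ k, j ≤ 𝔖.ep k := by
  induction j with
  | zero => exact ⟨0, Nat.zero_le _⟩
  | succ j ih =>
    obtain ⟨k₀, hk₀⟩ := ih
    by_contra hcon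
    have hcon : ∀ k, 𝔖.ep k < j + 1 := fun k => not_le.mp fun hle => hcon ⟨k, hle⟩
    have hconst : ∀ k, k₀ ≤ k → 𝔖.ep k = j := fun k hk => by
      have h1 := 𝔖.ep_mono hk
      have h2 := hcon k
      omega
    obtain ⟨k, hth, hk⟩ := ((𝔖.room_eventually (j + 1)).and (eventually_ge_atTop (k₀ + 1))).exists
    obtain ⟨m, rfl⟩ : ∃ m, k = m + 1 := ⟨k - 1, by omega⟩
    have hm : 𝔖.ep m = j := hconst m (by omega)
    rcases 𝔖.traj_cases m with ⟨-, hi, -⟩ | ⟨hnt, -, -⟩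
    · have := hcon (m + 1); omega
    · exact hnt (by rw [hm]; exact hth)

/-- Every epoch index is attained. [folklore] -/
lemma exists_ep_eq (j : ℕ) : ∃ k, 𝔖.ep k = j := by
  obtain ⟨k, hk⟩ := 𝔖.ep_unbounded j
  obtain ⟨k', -, e⟩ := 𝔖.exists_ep_eq_of_le hk
  exact ⟨k', e⟩

/-- The pivot times: `pt j` = the first time the epoch index is `j`. [cite: Enflo2023, v2 p.20] -/
def pt (j : ℕ) : ℕ := Nat.find (𝔖.exists_ep_eq j)

/-- `ep (pt j) = j`. [folklore] -/
lemma ep_pt (j : ℕ) : 𝔖.ep (𝔖.pt j) = j := Nat.find_spec (𝔖.exists_ep_eq j)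

/-- `pt j` is the least time with index `j`. [folklore] -/
lemma pt_le {j k : ℕ} (h : 𝔖.ep k = j) : 𝔖.pt j ≤ k := Nat.find_min' _ h

/-- `pt 0 = 0`. [folklore] -/
lemma pt_zero : 𝔖.pt 0 = 0 := by
  have := 𝔖.pt_le (j := 0) (k := 0) 𝔖.ep_zero; omega

/-- The pivot times are strictly increasing. [folklore] -/
lemma pt_strictMono : StrictMono 𝔖.pt := strictMono_nat_of_lt_succ fun j => by
  refine not_le.mp fun h => ?_
  have := 𝔖.ep_mono h
  rw [𝔖.ep_pt, 𝔖.ep_pt] at this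
  omega

/-- Times in `[pt j, pt (j+1))` carry epoch index `j`. [folklore] -/
lemma ep_eq_of_mem_epoch {j k : ℕ} (h1 : 𝔖.pt j ≤ k) (h2 : k < 𝔖.pt (j + 1)) : 𝔖.ep k = j := by
  have hge : j ≤ 𝔖.ep k := by
    have := 𝔖.ep_mono h1; rw [𝔖.ep_pt] at this; exact this
  by_contra hne
  have hgt : j + 1 ≤ 𝔖.ep k := by omega
  obtain ⟨k', hk', e⟩ := 𝔖.exists_ep_eq_of_le hgt
  have := 𝔖.pt_le e
  omega

/-- While the epoch index is `j`, the current pivot is the state at time `pt j`. [folklore] -/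
lemma pivot_eq_of_ep : ∀ k j, 𝔖.ep k = j → (𝔖.traj k).P = (𝔖.traj (𝔖.pt j)).s := by
  intro k
  induction k with
  | zero =>
    intro j hj
    rw [𝔖.ep_zero] at hj
    subst hj
    have e : 𝔖.pt 0 = 0 := 𝔖.pt_zero
    calc (𝔖.traj 0).P = (𝔖.traj 0).s := rfl
      _ = (𝔖.traj (𝔖.pt 0)).s := by rw [e]
  | succ k ih =>
    intro j hj
    rcases 𝔖.traj_cases k with ⟨-, hi, hP⟩ | ⟨-, hi, hP⟩
    · have hpj : 𝔖.pt j = k + 1 := by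
        have h1 : 𝔖.pt j ≤ k + 1 := 𝔖.pt_le hj
        have h2 : ¬ 𝔖.pt j ≤ k := fun hle => by
          have := 𝔖.ep_mono hle; rw [𝔖.ep_pt] at this; omega
        omega
      rw [hP, hpj]
    · rw [hP]; exact ih j (by omega)

/-- The side-condition vector of epoch `j` (the `w₀₀` of the `j`-th pivot). [cite: Enflo2023, v2 (40), p.18] -/
def wt (j : ℕ) : H := 𝔖.w (𝔖.traj (𝔖.pt j)).s

/-- The angle bound of epoch `j`: `G((εθ)_{pt j})`. [cite: Enflo2023, v2 (40), p.18] -/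
def gt (j : ℕ) : ℝ := 𝔖.G (𝔖.et (𝔖.pt j))

/-- (46) holds throughout epoch `j` with the epoch's vector. [cite: Enflo2023, v2 (46), p.19] -/
lemma side_epoch (j k : ℕ) (h1 : 𝔖.pt j ≤ k) (h2 : k < 𝔖.pt (j + 1)) :
    ⟪𝔖.wt j, 𝔖.vt (k + 1) - 𝔖.vt k⟫_ℂ = 0 := by
  have hP := 𝔖.pivot_eq_of_ep k j (𝔖.ep_eq_of_mem_epoch h1 h2)
  have := 𝔖.side_succ k
  rw [hP] at this
  exact this

/-- (40) at every pivot. [cite: Enflo2023, v2 (40), p.18] -/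
lemma wt_angle (j : ℕ) :
    ‖((‖𝔖.x₀ - 𝔖.vt (𝔖.pt j)‖ : ℝ) : ℂ) • 𝔖.wt j - ((‖𝔖.wt j‖ : ℝ) : ℂ) • (𝔖.x₀ - 𝔖.vt (𝔖.pt j))‖
      ≤ 𝔖.gt j * (‖𝔖.wt j‖ * ‖𝔖.x₀ - 𝔖.vt (𝔖.pt j)‖) :=
  𝔖.w_angle (𝔖.traj (𝔖.pt j)).s

/-- At the `(j+1)`-st pivot the room threshold of level `j+1` was met. [folklore] -/
lemma room_pt_succ (j : ℕ) : 𝔖.room (𝔖.traj (𝔖.pt (j + 1))).s (j + 1) := by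
  obtain ⟨m, hm⟩ : ∃ m, 𝔖.pt (j + 1) = m + 1 :=
    ⟨𝔖.pt (j + 1) - 1, by have := 𝔖.pt_strictMono (Nat.lt_add_one j); omega⟩
  have h1 : 𝔖.ep (m + 1) = j + 1 := by rw [← hm]; exact 𝔖.ep_pt _
  have h2 : 𝔖.ep m ≤ j := by
    refine not_lt.mp fun h => ?_
    obtain ⟨k', hk', e⟩ := 𝔖.exists_ep_eq_of_le (show j + 1 ≤ 𝔖.ep m by omega)
    have := 𝔖.pt_le e
    omega
  rcases 𝔖.traj_cases m with ⟨ht, hi, -⟩ | ⟨-, hi, -⟩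
  · have hmj : 𝔖.ep m = j := by omega
    rw [hm]; rw [hmj] at ht; exact ht
  · omega

/-- The rooms are summable: `Σ_j (2 g_j + √((1+C)(εθ)_{pt j})) < ∞` (each term `≤ 2^{-j}` for `j ≥ 1`). [cite: Enflo2023, v2 p.20] -/
lemma summable_rooms :
    Summable (fun j => 2 * 𝔖.gt j + Real.sqrt ((1 + 𝔖.C) * 𝔖.et (𝔖.pt j))) := by
  have hnn : ∀ j, 0 ≤ 2 * 𝔖.gt j + Real.sqrt ((1 + 𝔖.C) * 𝔖.et (𝔖.pt j)) := fun j =>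
    add_nonneg (mul_nonneg zero_le_two (𝔖.hG0 _)) (Real.sqrt_nonneg _)
  rw [← summable_nat_add_iff 1]
  have hgeo : Summable (fun j : ℕ => (1 / 2 : ℝ) ^ (j + 1)) :=
    ((summable_geometric_of_lt_one (by norm_num : (0 : ℝ) ≤ 1 / 2) (by norm_num)).mul_right
      (1 / 2)).congr (fun j => by ring)
  refine Summable.of_nonneg_of_le (fun j => hnn (j + 1)) (fun j => ?_) hgeo
  have h := 𝔖.room_pt_succ j
  unfold room at h
  exact h

/-- **The endgame of an abstract step system.**  If along the certified states the window `0.3 ≤ ‖v‖ ≤ 0.7`,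
(9) `|⟨v, T^j(x₀ − v)⟩| ≤ (εθ)` and (16) `(εθ) = ⟨v, x₀ − v⟩` hold for an operator `T` (`‖x₀‖ = 1`), then the
trajectory satisfies every hypothesis of `Eq45.hasNontrivialClosedInvariantSubspace_of_repivoting_C`, and `T` has a
non-trivial closed invariant subspace. [cite: Enflo2023, v2 p.17–20, (40), (45)–(47), p.22 (11)] -/
theorem nis [CompleteSpace H] (T : H →L[ℂ] H) (hx₀ : ‖𝔖.x₀‖ = 1) (hwin : ∀ s : σ, (0.3 : ℝ) ≤ ‖𝔖.v s‖ ∧ ‖𝔖.v s‖ ≤ 0.7)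
    (h9 : ∀ (s : σ) (j : ℕ), ‖⟪𝔖.v s, (T ^ j) (𝔖.x₀ - 𝔖.v s)⟫_ℂ‖ ≤ 𝔖.e s)
    (hid : ∀ s : σ, ((𝔖.e s : ℝ) : ℂ) = ⟪𝔖.v s, 𝔖.x₀ - 𝔖.v s⟫_ℂ) :
    HasNontrivialClosedInvariantSubspace T :=
  Eq45.hasNontrivialClosedInvariantSubspace_of_repivoting_C T 𝔖.x₀ hx₀ 𝔖.vt 𝔖.et 𝔖.β 𝔖.C 𝔖.hC
    (fun _ => hwin _) (fun _ j => h9 _ j) (fun _ => hid _)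
    𝔖.et_nonneg 𝔖.et_antitone 𝔖.et_tendsto 𝔖.drift_succ 𝔖.et_succ_le
    𝔖.pt 𝔖.pt_strictMono 𝔖.wt 𝔖.gt (fun _ => 𝔖.w_ne_zero _) (fun _ => 𝔖.hG0 _)
    𝔖.wt_angle 𝔖.side_epoch 𝔖.summable_rooms

end StepSystem

end Abstract

end MCStep

namespace MCStep

variable {E H : Type*} [NormedAddCommGroup E] [InnerProductSpace ℂ E] [CompleteSpace E]
  [NormedAddCommGroup H] [InnerProductSpace ℂ H] [CompleteSpace H]

/-! ### The step claim restricted to a class of states -/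

/-- **The step claim restricted to a class `Good` of states** (v2 p.17 l.578–583 with (40), (45), (46), asked only
where the run goes): at every pivot state `P ∈ Good` there is a side-condition vector `c ≠ 0` within angle
`G((εθ)_P)` of the moved vector `x₀ − v_P` ((40)), such that from every state `s ∈ Good` in `P`'s epoch invariant
ONE MORE step exists and lands in `Good`: a true MC state `s' ∈ Good` with (b') `(εθ)_{s'} ≤ (1−β)(εθ)_s`, (46)
`⟨c, v_{s'} − v_s⟩ = 0`, (45) `|Re⟨x₀, v_{s'} − v_s⟩| ≤ Cβ(εθ)_s`.  A HYPOTHESIS below, never a theorem.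
[cite: Enflo2023, v2 p.17–19, (40), (45), (46)] -/
def ClaimG (T : H →L[ℂ] H) (x₀ : H) (S : E →L[ℂ] E) (C β : ℝ) (G : ℝ → ℝ) (Good : State T x₀ S → Prop) :
    Prop :=
  ∀ P : State T x₀ S, Good P → ∃ c : H, c ≠ 0 ∧
    ‖((‖x₀ - P.v‖ : ℝ) : ℂ) • c - ((‖c‖ : ℝ) : ℂ) • (x₀ - P.v)‖ ≤ G P.etheta * (‖c‖ * ‖x₀ - P.v‖) ∧
    ∀ s : State T x₀ S, Good s → InvP C P c s →
      ∃ s' : State T x₀ S, Good s' ∧ s'.etheta ≤ (1 - β) * s.etheta ∧ ⟪c, s'.v - s.v⟫_ℂ = 0 ∧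
        |re ⟪x₀, s'.v - s.v⟫_ℂ| ≤ C * β * s.etheta

omit [CompleteSpace E] [CompleteSpace H] in
/-- With no restriction (`Good = ⊤`) the restricted claim is `MCStep.Claim` itself. [cite: Enflo2023, v2 p.17 l.578–583] -/
theorem claimG_top_iff (T : H →L[ℂ] H) (x₀ : H) (S : E →L[ℂ] E) (C β : ℝ) (G : ℝ → ℝ) :
    ClaimG T x₀ S C β G (fun _ => True) ↔ Claim T x₀ S C β G := by
  constructor
  · intro h P
    obtain ⟨c, hc, hang, hstep⟩ := h P trivial
    refine ⟨c, hc, hang, fun s hs => ?_⟩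
    obtain ⟨s', -, h1, h2, h3⟩ := hstep s trivial hs
    exact ⟨s', h1, h2, h3⟩
  · intro h P _
    obtain ⟨c, hc, hang, hstep⟩ := h P
    refine ⟨c, hc, hang, fun s _ hs => ?_⟩
    obtain ⟨s', h1, h2, h3⟩ := hstep s hs
    exact ⟨s', trivial, h1, h2, h3⟩

omit [CompleteSpace E] [CompleteSpace H] in
/-- `Claim` gives the restricted claim for every class that is closed under admissible steps from `InvP`-states
(the case of reachability classes below). [cite: Enflo2023, v2 p.17 l.578–583] -/
theorem claimG_of_claim_of_closed {T : H →L[ℂ] H} {x₀ : H} {S : E →L[ℂ] E} {C β : ℝ} {G : ℝ → ℝ}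
    (h : Claim T x₀ S C β G) {Good : State T x₀ S → Prop}
    (hclosed : ∀ s s' : State T x₀ S, Good s → s'.etheta ≤ (1 - β) * s.etheta →
      |re ⟪x₀, s'.v - s.v⟫_ℂ| ≤ C * β * s.etheta → Good s') :
    ClaimG T x₀ S C β G Good := by
  intro P _
  obtain ⟨c, hc, hang, hstep⟩ := h P
  refine ⟨c, hc, hang, fun s hs hinv => ?_⟩
  obtain ⟨s', h1, h2, h3⟩ := hstep s hinv
  exact ⟨s', hclosed s s' hs h1 h3, h1, h2, h3⟩

/-! ### The endgame from the restricted claim and one `Good` start state -/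

section OfClaimG

variable {T : H →L[ℂ] H} {x₀ : H} {S : E →L[ℂ] E} {C β : ℝ} {G : ℝ → ℝ} {Good : State T x₀ S → Prop}

/-- The side-condition vector the restricted claim provides at a `Good` pivot. [cite: Enflo2023, v2 (40), p.18] -/
def pivG (hclaim : ClaimG T x₀ S C β G Good) (P : {s : State T x₀ S // Good s}) : H :=
  Classical.choose (hclaim P.1 P.2)

omit [CompleteSpace E] [CompleteSpace H] in
/-- Its specification: non-zero, (40), and the step clause from `Good` states. [cite: Enflo2023, v2 (40) p.18, p.19] -/
lemma pivG_spec (hclaim : ClaimG T x₀ S C β G Good) (P : {s : State T x₀ S // Good s}) :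
    pivG hclaim P ≠ 0 ∧
      ‖((‖x₀ - P.1.v‖ : ℝ) : ℂ) • pivG hclaim P - ((‖pivG hclaim P‖ : ℝ) : ℂ) • (x₀ - P.1.v)‖
          ≤ G P.1.etheta * (‖pivG hclaim P‖ * ‖x₀ - P.1.v‖) ∧
      ∀ s : State T x₀ S, Good s → InvP C P.1 (pivG hclaim P) s →
        ∃ s' : State T x₀ S, Good s' ∧ s'.etheta ≤ (1 - β) * s.etheta ∧ ⟪pivG hclaim P, s'.v - s.v⟫_ℂ = 0 ∧
          |re ⟪x₀, s'.v - s.v⟫_ℂ| ≤ C * β * s.etheta :=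
  Classical.choose_spec (hclaim P.1 P.2)

/-- The step the restricted claim provides, as a `Good` state. [cite: Enflo2023, v2 p.19] -/
def stepG (hclaim : ClaimG T x₀ S C β G Good) (P s : {s : State T x₀ S // Good s})
    (h : InvP C P.1 (pivG hclaim P) s.1) : {s : State T x₀ S // Good s} :=
  ⟨Classical.choose ((pivG_spec hclaim P).2.2 s.1 s.2 h),
    (Classical.choose_spec ((pivG_spec hclaim P).2.2 s.1 s.2 h)).1⟩

omit [CompleteSpace E] [CompleteSpace H] in
/-- Its specification: (b'), (46), (45). [cite: Enflo2023, v2 (45)–(46), p.19] -/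
lemma stepG_spec (hclaim : ClaimG T x₀ S C β G Good) (P s : {s : State T x₀ S // Good s})
    (h : InvP C P.1 (pivG hclaim P) s.1) :
    (stepG hclaim P s h).1.etheta ≤ (1 - β) * s.1.etheta ∧
      ⟪pivG hclaim P, (stepG hclaim P s h).1.v - s.1.v⟫_ℂ = 0 ∧
      |re ⟪x₀, (stepG hclaim P s h).1.v - s.1.v⟫_ℂ| ≤ C * β * s.1.etheta :=
  (Classical.choose_spec ((pivG_spec hclaim P).2.2 s.1 s.2 h)).2

/-- **The step system of the restricted claim**: certified states = `Good` states, `w` = the claim's vector,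
`next` = the claim's step. [cite: Enflo2023, v2 p.17–20] -/
def systemOfClaimG (hx₀ : ‖x₀‖ = 1) (hS : ‖S‖ ≤ 1) (hC : 0 ≤ C) (hβ : 0 < β) (hβ1 : β ≤ 1)
    (hG0 : ∀ x, 0 ≤ G x) (hG : ∀ η : ℝ, 0 < η → ∃ δ : ℝ, 0 < δ ∧ ∀ x, 0 ≤ x → x ≤ δ → G x ≤ η)
    (hclaim : ClaimG T x₀ S C β G Good) (s₀ : State T x₀ S) (h₀ : Good s₀) :
    StepSystem H {s : State T x₀ S // Good s} where
  x₀ := x₀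
  C := C
  β := β
  G := G
  v := fun s => s.1.v
  e := fun s => s.1.etheta
  hC := hC
  hβ := hβ
  hβ1 := hβ1
  hG0 := hG0
  hG := hG
  e_nonneg := fun s => s.1.etheta_nonneg hx₀ hS
  w := pivG hclaim
  w_ne_zero := fun P => (pivG_spec hclaim P).1
  w_angle := fun P => (pivG_spec hclaim P).2.1
  next := fun P s h => stepG hclaim P s h
  next_ratio := fun P s h => (stepG_spec hclaim P s h).1
  next_side := fun P s h => (stepG_spec hclaim P s h).2.1
  next_drift := fun P s h => (stepG_spec hclaim P s h).2.2
  s₀ := ⟨s₀, h₀⟩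

end OfClaimG

/-- **The endgame from the restricted claim**: `‖x₀‖ = 1`, `‖S‖ ≤ 1`, `0 ≤ C`, `0 < β ≤ 1`, `G ≥ 0` with
`G(E) → 0⁺`, the claim restricted to `Good`, and ONE state in `Good` ⟹ a non-trivial closed invariant subspace
(`StepSystem.nis` for `systemOfClaimG`; the window, (9) and (16) hold at every true MC state).  With `Good = ⊤` this
is `MCStep.hasNontrivialClosedInvariantSubspace_of_claim` (`claimG_top_iff`). [cite: Enflo2023, v2 p.17–20, (40), (45)–(47), (11)] -/
theorem nis_of_claimG (T : H →L[ℂ] H) (x₀ : H) (hx₀ : ‖x₀‖ = 1) (S : E →L[ℂ] E) (hS : ‖S‖ ≤ 1) {C β : ℝ}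
    (hC : 0 ≤ C) (hβ : 0 < β) (hβ1 : β ≤ 1) (G : ℝ → ℝ) (hG0 : ∀ x, 0 ≤ G x)
    (hG : ∀ η : ℝ, 0 < η → ∃ δ : ℝ, 0 < δ ∧ ∀ x, 0 ≤ x → x ≤ δ → G x ≤ η)
    {Good : State T x₀ S → Prop} (hclaim : ClaimG T x₀ S C β G Good) (s₀ : State T x₀ S) (h₀ : Good s₀) :
    HasNontrivialClosedInvariantSubspace T :=
  (systemOfClaimG hx₀ hS hC hβ hβ1 hG0 hG hclaim s₀ h₀).nis T hx₀ (fun s => s.1.window hx₀)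
    (fun s j => s.1.h9 hx₀ hS j) (fun s => s.1.hid hx₀)

/-! ### Reachable states and the run-restricted residual -/

/-- **The states reachable from `s₀`** by admissible steps maintaining an invariant `N`: `s₀` itself, and any true
MC state `s'` with `N s'` reached from a reachable `s` by a step with the ratio target (b') `(εθ)_{s'} ≤ (1−β)(εθ)_s`
and the drift bound (45) `|Re⟨x₀, v_{s'} − v_s⟩| ≤ Cβ(εθ)_s`.  Every state of every run the endgame builds from
`s₀` is reachable. [cite: Enflo2023, v2 (13) p.6, p.17 l.578–583, (45) p.19] -/
inductive ReachN {T : H →L[ℂ] H} {x₀ : H} {S : E →L[ℂ] E} (C β : ℝ) (N : State T x₀ S → Prop)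
    (s₀ : State T x₀ S) : State T x₀ S → Prop
  | start : ReachN C β N s₀ s₀
  | step {s s' : State T x₀ S} : ReachN C β N s₀ s → N s' → s'.etheta ≤ (1 - β) * s.etheta →
      |re ⟪x₀, s'.v - s.v⟫_ℂ| ≤ C * β * s.etheta → ReachN C β N s₀ s'

/-- **The run-restricted residual of Part B**: the step claim asked ONLY at pivots reachable from `s₀` and at
reachable states in their epoch invariants, each step landing in a true MC state that keeps the invariant `N`
("we use MC with this restriction until `n = n₁'` … then we put in another restriction …", v2 p.19–20, along THE
run).  A HYPOTHESIS below, never a theorem. [cite: Enflo2023, v2 p.17 l.578–583; (40) p.18; (45), (46) p.19; p.20] -/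
def ClaimRun (T : H →L[ℂ] H) (x₀ : H) (S : E →L[ℂ] E) (C β : ℝ) (G : ℝ → ℝ) (N : State T x₀ S → Prop)
    (s₀ : State T x₀ S) : Prop :=
  ∀ P : State T x₀ S, ReachN C β N s₀ P → ∃ c : H, c ≠ 0 ∧
    ‖((‖x₀ - P.v‖ : ℝ) : ℂ) • c - ((‖c‖ : ℝ) : ℂ) • (x₀ - P.v)‖ ≤ G P.etheta * (‖c‖ * ‖x₀ - P.v‖) ∧
    ∀ s : State T x₀ S, ReachN C β N s₀ s → InvP C P c s →
      ∃ s' : State T x₀ S, N s' ∧ s'.etheta ≤ (1 - β) * s.etheta ∧ ⟪c, s'.v - s.v⟫_ℂ = 0 ∧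
        |re ⟪x₀, s'.v - s.v⟫_ℂ| ≤ C * β * s.etheta

omit [CompleteSpace E] [CompleteSpace H] in
/-- The run-restricted residual IS the claim restricted to the reachability class. [cite: Enflo2023, v2 p.17–20] -/
theorem claimG_of_claimRun {T : H →L[ℂ] H} {x₀ : H} {S : E →L[ℂ] E} {C β : ℝ} {G : ℝ → ℝ}
    {N : State T x₀ S → Prop} {s₀ : State T x₀ S} (h : ClaimRun T x₀ S C β G N s₀) :
    ClaimG T x₀ S C β G (ReachN C β N s₀) := by
  intro P hP
  obtain ⟨c, hc, hang, hstep⟩ := h P hP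
  refine ⟨c, hc, hang, fun s hs hinv => ?_⟩
  obtain ⟨s', hN, h1, h2, h3⟩ := hstep s hs hinv
  exact ⟨s', ReachN.step hs hN h1 h3, h1, h2, h3⟩

omit [CompleteSpace E] [CompleteSpace H] in
/-- Conversely, the claim restricted to the reachability class gives the run-restricted residual whenever the
invariant holds on the class (e.g. `N = ⊤`). [cite: Enflo2023, v2 p.17–20] -/
theorem claimRun_of_claimG {T : H →L[ℂ] H} {x₀ : H} {S : E →L[ℂ] E} {C β : ℝ} {G : ℝ → ℝ}
    {N : State T x₀ S → Prop} {s₀ : State T x₀ S} (h : ClaimG T x₀ S C β G (ReachN C β N s₀))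
    (hN : ∀ s, ReachN C β N s₀ s → N s) : ClaimRun T x₀ S C β G N s₀ := by
  intro P hP
  obtain ⟨c, hc, hang, hstep⟩ := h P hP
  refine ⟨c, hc, hang, fun s hs hinv => ?_⟩
  obtain ⟨s', hR, h1, h2, h3⟩ := hstep s hs hinv
  exact ⟨s', hN s' hR, h1, h2, h3⟩

/-- **The endgame from the run-restricted residual**: `‖x₀‖ = 1`, `‖S‖ ≤ 1`, `0 ≤ C`, `0 < β ≤ 1`, `G ≥ 0` with
`G(E) → 0⁺`, ONE state `s₀`, and `ClaimRun … N s₀` ⟹ `T` has a non-trivial closed invariant subspace.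
[cite: Enflo2023, v2 p.17–20, (40), (45)–(47), p.22 (11)] -/
theorem nis_of_claimRun (T : H →L[ℂ] H) (x₀ : H) (hx₀ : ‖x₀‖ = 1) (S : E →L[ℂ] E) (hS : ‖S‖ ≤ 1) {C β : ℝ}
    (hC : 0 ≤ C) (hβ : 0 < β) (hβ1 : β ≤ 1) (G : ℝ → ℝ) (hG0 : ∀ x, 0 ≤ G x)
    (hG : ∀ η : ℝ, 0 < η → ∃ δ : ℝ, 0 < δ ∧ ∀ x, 0 ≤ x → x ≤ δ → G x ≤ η)
    {N : State T x₀ S → Prop} (s₀ : State T x₀ S) (hclaim : ClaimRun T x₀ S C β G N s₀) :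
    HasNontrivialClosedInvariantSubspace T :=
  nis_of_claimG T x₀ hx₀ S hS hC hβ hβ1 G hG0 hG (claimG_of_claimRun hclaim) s₀ ReachN.start

omit [CompleteSpace E] [CompleteSpace H] in
/-- **The run-restricted residual (with no invariant) is WEAKER than `MCStep.Claim`**: the uniform claim gives it
from every start state. [cite: Enflo2023, v2 p.17 l.578–583] -/
theorem claimRun_top_of_claim {T : H →L[ℂ] H} {x₀ : H} {S : E →L[ℂ] E} {C β : ℝ} {G : ℝ → ℝ}
    (h : Claim T x₀ S C β G) (s₀ : State T x₀ S) : ClaimRun T x₀ S C β G (fun _ => True) s₀ := by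
  intro P _
  obtain ⟨c, hc, hang, hstep⟩ := h P
  refine ⟨c, hc, hang, fun s _ hinv => ?_⟩
  obtain ⟨s', h1, h2, h3⟩ := hstep s hinv
  exact ⟨s', trivial, h1, h2, h3⟩

omit [CompleteSpace E] [CompleteSpace H] in
/-- More generally `Claim` gives the run-restricted residual for any invariant that every true MC state satisfies.
[cite: Enflo2023, v2 p.17 l.578–583] -/
theorem claimRun_of_claim {T : H →L[ℂ] H} {x₀ : H} {S : E →L[ℂ] E} {C β : ℝ} {G : ℝ → ℝ}
    (h : Claim T x₀ S C β G) {N : State T x₀ S → Prop} (hN : ∀ s, N s) (s₀ : State T x₀ S) :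
    ClaimRun T x₀ S C β G N s₀ := by
  intro P _
  obtain ⟨c, hc, hang, hstep⟩ := h P
  refine ⟨c, hc, hang, fun s _ hinv => ?_⟩
  obtain ⟨s', h1, h2, h3⟩ := hstep s hinv
  exact ⟨s', hN s', h1, h2, h3⟩

namespace ReachN

variable {T : H →L[ℂ] H} {x₀ : H} {S : E →L[ℂ] E} {C β : ℝ} {N : State T x₀ S → Prop} {s₀ s : State T x₀ S}

omit [CompleteSpace E] [CompleteSpace H] in
/-- A reachable state other than the start satisfies the invariant; so all do if the start does. [cite: Enflo2023, v2 p.15 (33), p.19] -/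
theorem inv (h : ReachN C β N s₀ s) (h₀ : N s₀) : N s := by
  induction h with
  | start => exact h₀
  | step _ hN _ _ _ => exact hN

omit [CompleteSpace E] [CompleteSpace H] in
/-- Reachability is monotone in the invariant. [folklore] -/
theorem mono {N' : State T x₀ S → Prop} (hNN' : ∀ s, N s → N' s) (h : ReachN C β N s₀ s) :
    ReachN C β N' s₀ s := by
  induction h with
  | start => exact ReachN.start
  | step _ hN h1 h3 ih => exact ReachN.step ih (hNN' _ hN) h1 h3

/-- **Run-level bound 1**: along reachable states `(εθ)` never exceeds its start value (`0 ≤ β ≤ 1`).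
[cite: Enflo2023, v2 (b') p.17, p.19 "get down to arbitrarily small `εθ`'s"] -/
theorem etheta_le (hx₀ : ‖x₀‖ = 1) (hS : ‖S‖ ≤ 1) (hβ : 0 ≤ β) (h : ReachN C β N s₀ s) :
    s.etheta ≤ s₀.etheta := by
  induction h with
  | start => exact le_rfl
  | @step t t' _ _ h1 _ ih =>
    have ht : 0 ≤ t.etheta := t.etheta_nonneg hx₀ hS
    have : (1 - β) * t.etheta ≤ t.etheta := by linarith [mul_nonneg hβ ht]
    exact h1.trans (this.trans ih)

omit [CompleteSpace E] [CompleteSpace H] in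
/-- **Run-level bound 2**: along reachable states the drift (45) accumulates to
`|Re⟨x₀, v_s − v₀⟩| ≤ C((εθ)₀ − (εθ)_s)` (`C ≥ 0`). [cite: Enflo2023, v2 (45) p.19: "a total of `10(εθ)₀`"] -/
theorem abs_re_inner_le (hC : 0 ≤ C) (h : ReachN C β N s₀ s) :
    |re ⟪x₀, s.v - s₀.v⟫_ℂ| ≤ C * (s₀.etheta - s.etheta) := by
  induction h with
  | start => simp
  | @step t t' _ _ h1 h3 ih =>
    have hsplit : t'.v - s₀.v = (t'.v - t.v) + (t.v - s₀.v) := by abel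
    rw [hsplit, inner_add_right, map_add]
    have hadd := abs_add_le (re ⟪x₀, t'.v - t.v⟫_ℂ) (re ⟪x₀, t.v - s₀.v⟫_ℂ)
    have h2 : C * β * t.etheta ≤ C * (t.etheta - t'.etheta) := by
      have : β * t.etheta ≤ t.etheta - t'.etheta := by linarith
      calc C * β * t.etheta = C * (β * t.etheta) := by ring
        _ ≤ C * (t.etheta - t'.etheta) := mul_le_mul_of_nonneg_left this hC
    linarith

omit [CompleteSpace E] [CompleteSpace H] in
/-- The window along reachable states is automatic (true MC states). [cite: Enflo2023, v2 p.5 l.152, p.17] -/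
theorem window (hx₀ : ‖x₀‖ = 1) (_h : ReachN C β N s₀ s) : (0.3 : ℝ) ≤ ‖s.v‖ ∧ ‖s.v‖ ≤ 0.7 :=
  s.window hx₀

end ReachN

/-! ### The weakest sufficient form: SOME class containing the start is closed under the claimed steps -/

omit [CompleteSpace E] [CompleteSpace H] in
/-- `ClaimRun … N s₀` exhibits a class containing `s₀` on which the restricted claim holds (the reachability class)
— "THE run from `s₀` can be built".  The converse fails in general: a class `Good ∋ s₀` with `ClaimG … Good` need
not answer at states reached by admissible steps it did not choose. [cite: Enflo2023, v2 p.17–20] -/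
theorem exists_claimG_of_claimRun {T : H →L[ℂ] H} {x₀ : H} {S : E →L[ℂ] E} {C β : ℝ} {G : ℝ → ℝ}
    {N : State T x₀ S → Prop} {s₀ : State T x₀ S} (h : ClaimRun T x₀ S C β G N s₀) :
    ∃ Good : State T x₀ S → Prop, Good s₀ ∧ ClaimG T x₀ S C β G Good :=
  ⟨ReachN C β N s₀, ReachN.start, claimG_of_claimRun h⟩

omit [CompleteSpace E] [CompleteSpace H] in
/-- With the invariant at the start, the exhibited class lies inside the invariant. [cite: Enflo2023, v2 p.17–20] -/
theorem exists_claimG_le_of_claimRun {T : H →L[ℂ] H} {x₀ : H} {S : E →L[ℂ] E} {C β : ℝ} {G : ℝ → ℝ}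
    {N : State T x₀ S → Prop} {s₀ : State T x₀ S} (h : ClaimRun T x₀ S C β G N s₀) (h₀ : N s₀) :
    ∃ Good : State T x₀ S → Prop, Good s₀ ∧ (∀ s, Good s → N s) ∧ ClaimG T x₀ S C β G Good :=
  ⟨ReachN C β N s₀, ReachN.start, fun _ hs => hs.inv h₀, claimG_of_claimRun h⟩

omit [CompleteSpace E] [CompleteSpace H] in
/-- The uniform claim exhibits the class of ALL states. [cite: Enflo2023, v2 p.17 l.578–583] -/
theorem exists_claimG_of_claim {T : H →L[ℂ] H} {x₀ : H} {S : E →L[ℂ] E} {C β : ℝ} {G : ℝ → ℝ}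
    (h : Claim T x₀ S C β G) (s₀ : State T x₀ S) :
    ∃ Good : State T x₀ S → Prop, Good s₀ ∧ ClaimG T x₀ S C β G Good :=
  ⟨fun _ => True, trivial, (claimG_top_iff T x₀ S C β G).2 h⟩

/-- **The endgame from the weakest sufficient residual**: standing constants, ONE state `s₀`, and SOME class
`Good ∋ s₀` with `ClaimG … Good` ⟹ a non-trivial closed invariant subspace. [cite: Enflo2023, v2 p.17–20, (40), (45)–(47), (11)] -/
theorem nis_of_exists_claimG (T : H →L[ℂ] H) (x₀ : H) (hx₀ : ‖x₀‖ = 1) (S : E →L[ℂ] E) (hS : ‖S‖ ≤ 1) {C β : ℝ}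
    (hC : 0 ≤ C) (hβ : 0 < β) (hβ1 : β ≤ 1) (G : ℝ → ℝ) (hG0 : ∀ x, 0 ≤ G x)
    (hG : ∀ η : ℝ, 0 < η → ∃ δ : ℝ, 0 < δ ∧ ∀ x, 0 ≤ x → x ≤ δ → G x ≤ η) {s₀ : State T x₀ S}
    (h : ∃ Good : State T x₀ S → Prop, Good s₀ ∧ ClaimG T x₀ S C β G Good) :
    HasNontrivialClosedInvariantSubspace T := by
  obtain ⟨Good, h₀, hclaim⟩ := h
  exact nis_of_claimG T x₀ hx₀ S hS hC hβ hβ1 G hG0 hG hclaim s₀ h₀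

end MCStep

/-! ### Part A made load-bearing: the residual asked only from start-quality states -/

namespace EndToEnd

variable {H : Type*} [NormedAddCommGroup H] [InnerProductSpace ℂ H] [CompleteSpace H]

open Vy Lemma2 MCStep

/-- **Start quality — the (33)-control** (the invariant the manuscript maintains along its Main Construction, in
the kernel form in which Part A hands it over, `exists_state_of_partA`): the state is the state of an ADMISSIBLE
vector `y` (`y ∈ Adm u₀`, `V = V_y`, v2 (13)) at a level `t ∈ (0, E₀]` ("arbitrarily small `(εθ)`", p.17, p.19) with
`(εθ)_s ≤ 3γ(t)^{1/2}` (Lemma 3 = Lemma 5, v2 p.10–11) and the start control (33) two-sided —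
`1 − γ(t) ≤ |a₀|² ≤ 1 − (0.98·10²⁰t¹¹)²`, `(0.98·10²⁰t¹¹)² ≤ Σ_{j≥1}|a_j|² ≤ γ(t)`, `(1 − γ(t))‖a‖² ≤ |a₀|²`
(`γ = Lemma2.gammaEps T u₀`; v2 p.15 (33) with (25): "we also want `|a₀|²` to follow the size of `(εθ)` such that
(25) and Lemmas 3, 4, and 5" hold).  At Part A's exit `t = (εθ)_{y_N} ≤ 1.12(εθ)₀`.
[cite: Enflo2023, v2 p.15 (33), tex L531–L537; p.10–11 Lemmas 3–5; p.12 (25); p.13 (26)] -/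
def Ctrl33 (T : H →L[ℂ] H) (hT : ‖T‖ < 1) (u₀ : H) (E₀ : ℝ) {x₀ : H} (s : State T x₀ Vy.S) : Prop :=
  ∃ (y : H) (t : ℝ), y ∈ Adm u₀ ∧ s.V = V T hT y ∧ 0 < t ∧ t ≤ E₀
    ∧ s.etheta ≤ 3 * Real.sqrt (gammaEps T hT u₀ t)
    ∧ 1 - gammaEps T hT u₀ t ≤ ‖s.a 0‖ ^ 2
    ∧ ‖s.a 0‖ ^ 2 ≤ 1 - (98 / 100 * 10 ^ 20 * t ^ 11) ^ 2
    ∧ (98 / 100 * 10 ^ 20 * t ^ 11) ^ 2 ≤ ‖L s.a‖ ^ 2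
    ∧ ‖L s.a‖ ^ 2 ≤ gammaEps T hT u₀ t
    ∧ (1 - gammaEps T hT u₀ t) * ‖s.a‖ ^ 2 ≤ ‖s.a 0‖ ^ 2

/-- **Part A's exit IS a start-quality state.**  Standing data at `y₀ = y₁'` (entry window
`0.3 + 2.2(εθ)₀ ≤ ‖x₀ − y₀‖ ≤ 0.7`): EITHER `T` has a non-trivial closed invariant subspace, OR there is a state
`s₀` with `Ctrl33 T hT u₀ (1.12(εθ)₀) s₀`. [cite: Enflo2023, v2 p.13 (26) tex L443–L450, p.15 (33)] -/
theorem exists_ctrl33_of_partA (T : H →L[ℂ] H) (hT : ‖T‖ < 1) (hT20 : ‖T‖ ≤ 1 / 10 ^ 20) (x₀ y₀ u₀ : H)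
    (hx₀ : ‖x₀‖ = 1)
    (hwin : 0.3 + 2.2 * (⟪x₀ - y₀, y₀⟫_ℂ).re ≤ ‖x₀ - y₀‖ ∧ ‖x₀ - y₀‖ ≤ 0.7) (him : (⟪x₀ - y₀, y₀⟫_ℂ).im = 0)
    (ht0 : 0 ≤ (⟪x₀ - y₀, y₀⟫_ℂ).re) (ht1 : (⟪x₀ - y₀, y₀⟫_ℂ).re ≤ 1 / 10 ^ 4)
    (h9 : ∀ m : ℕ, ‖⟪x₀ - y₀, (T ^ m) y₀⟫_ℂ‖ ≤ (⟪x₀ - y₀, y₀⟫_ℂ).re)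
    (hu₀ : ‖u₀‖ ≤ 1) (hA : ‖y₀‖ / 100 ≤ (⟪u₀, y₀⟫_ℂ).re) :
    HasNontrivialClosedInvariantSubspace T ∨
      ∃ s₀ : State T x₀ Vy.S, Ctrl33 T hT u₀ (1.12 * (⟪x₀ - y₀, y₀⟫_ℂ).re) s₀ := by
  rcases exists_state_of_partA T hT hT20 x₀ y₀ u₀ hx₀ hwin him ht0 ht1 h9 hu₀ hA with hinv |
      ⟨y, s, hV, hε, htpos, -, htle, -, hAdm, h9N, -, h33a, h33b, h33c, h33d, h33e⟩
  · exact Or.inl hinv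
  · -- Lemma 3 = Lemma 5 at the exit vector: `(εθ)_s ≤ 3γ(t)^{1/2}` (v2 p.10–11)
    have hmin : IsMinimal (V T hT y) x₀ ‖x₀ - y‖ s.a := by
      have h := s.hmin
      rw [hV, hε] at h
      exact h
    have hTK : ‖T‖ ≤ 1 / bigK := by unfold bigK; exact hT20
    have h8 : (⟪x₀ - y, y⟫_ℂ).re ≤ 8 := by linarith
    have hxy : ‖x₀ - y‖ ≤ 1 := by rw [← hε]; linarith [s.hε.2]
    have hEθ : s.etheta ≤ 3 * Real.sqrt (gammaEps T hT u₀ (⟪x₀ - y, y⟫_ℂ).re) := by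
      have h3 := lemma3_etheta T hT hTK u₀ hAdm.1 hxy htpos h8 h9N hmin
      show (⟪x₀ - s.V s.a, s.V s.a⟫_ℂ).re ≤ _
      rw [hV]; exact h3
    exact Or.inr ⟨s, y, (⟪x₀ - y, y⟫_ℂ).re, hAdm, hV, htpos, htle, hEθ, h33a, h33b, h33c, h33d, h33e⟩

/-- **Part A ⟶ Part B with Part A load-bearing.**  Standing data at `y₁'` (as in `exists_state_of_partA`) AND the
run-restricted residual asked only from start-quality states — for every state `s₀` with
`Ctrl33 T hT u₀ (1.12(εθ)₀) s₀`, THE run from `s₀` can always be continued by one more admissible step that lands in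
a start-quality state (`ClaimRun T x₀ Vy.S C β G (Ctrl33 …) s₀`) — give a non-trivial closed invariant subspace.
The residual is invoked at Part A's exit state (`exists_ctrl33_of_partA`) and nowhere else; if THE (26)-run never
exits through Case I it is not invoked at all.  This is an IMPLICATION; its residual hypothesis is open (v2 p.17 l.578–583, argued in the text
by (34)–(46)). [cite: Enflo2023, v2 p.13 (26), p.15 (33), p.17 l.578–583, pp.18–20 (40)–(46), p.22 (11)] -/
theorem nis_of_partA_and_claimRun (T : H →L[ℂ] H) (hT : ‖T‖ < 1) (hT20 : ‖T‖ ≤ 1 / 10 ^ 20) (x₀ y₀ u₀ : H)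
    (hx₀ : ‖x₀‖ = 1)
    (hwin : 0.3 + 2.2 * (⟪x₀ - y₀, y₀⟫_ℂ).re ≤ ‖x₀ - y₀‖ ∧ ‖x₀ - y₀‖ ≤ 0.7) (him : (⟪x₀ - y₀, y₀⟫_ℂ).im = 0)
    (ht0 : 0 ≤ (⟪x₀ - y₀, y₀⟫_ℂ).re) (ht1 : (⟪x₀ - y₀, y₀⟫_ℂ).re ≤ 1 / 10 ^ 4)
    (h9 : ∀ m : ℕ, ‖⟪x₀ - y₀, (T ^ m) y₀⟫_ℂ‖ ≤ (⟪x₀ - y₀, y₀⟫_ℂ).re)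
    (hu₀ : ‖u₀‖ ≤ 1) (hA : ‖y₀‖ / 100 ≤ (⟪u₀, y₀⟫_ℂ).re)
    {C β : ℝ} (hC : 0 ≤ C) (hβ : 0 < β) (hβ1 : β ≤ 1) (G : ℝ → ℝ) (hG0 : ∀ x, 0 ≤ G x)
    (hG : ∀ η : ℝ, 0 < η → ∃ δ : ℝ, 0 < δ ∧ ∀ x, 0 ≤ x → x ≤ δ → G x ≤ η)
    (hclaim : ∀ s₀ : State T x₀ Vy.S, Ctrl33 T hT u₀ (1.12 * (⟪x₀ - y₀, y₀⟫_ℂ).re) s₀ →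
      ClaimRun T x₀ Vy.S C β G (Ctrl33 T hT u₀ (1.12 * (⟪x₀ - y₀, y₀⟫_ℂ).re)) s₀) :
    HasNontrivialClosedInvariantSubspace T := by
  rcases exists_ctrl33_of_partA T hT hT20 x₀ y₀ u₀ hx₀ hwin him ht0 ht1 h9 hu₀ hA with hinv | ⟨s₀, hs₀⟩
  · exact hinv
  · exact nis_of_claimRun T x₀ hx₀ Vy.S Vy.norm_S_le hC hβ hβ1 G hG0 hG s₀ (hclaim s₀ hs₀)

/-- Along the run from a start-quality state every state the residual is ever asked about is start-quality, with
`(εθ) ≤ (εθ)_{s₀}` and accumulated drift `≤ C((εθ)_{s₀} − (εθ))` — the manuscript's "arbitrarily small `(εθ)`'s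
without changing `⟨[ ]⁻¹x₀, x₀⟩` more than a total of `10(εθ)₀`" (p.19) in the kernel reading. [cite: Enflo2023, v2 (45) p.19, p.15 (33)] -/
theorem reach_ctrl33 {T : H →L[ℂ] H} {hT : ‖T‖ < 1} {u₀ x₀ : H} {E₀ C β : ℝ} (hx₀ : ‖x₀‖ = 1) (hC : 0 ≤ C)
    (hβ : 0 ≤ β) {s₀ s : State T x₀ Vy.S} (h₀ : Ctrl33 T hT u₀ E₀ s₀)
    (h : ReachN C β (Ctrl33 T hT u₀ E₀) s₀ s) :
    Ctrl33 T hT u₀ E₀ s ∧ s.etheta ≤ s₀.etheta ∧ |re ⟪x₀, s.v - s₀.v⟫_ℂ| ≤ C * (s₀.etheta - s.etheta) :=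
  ⟨h.inv h₀, h.etheta_le hx₀ Vy.norm_S_le hβ, h.abs_re_inner_le hC⟩

/-- **The run-restricted Part-B residual, packaged over all normalised operators** (companion of
`EndToEnd.PartBResidual`): on every separable infinite-dimensional Hilbert space, every operator of norm `10⁻²⁰`
EITHER has a non-trivial closed invariant subspace OR admits Part A's standing data at some `y₀ = y₁'` (unit `x₀`,
direction `u₀`, entry window, `Im⟨x₀ − y₀, y₀⟩ = 0`, `0 ≤ (εθ)₀ ≤ 10⁻⁴`, (9) at `y₀`, `‖u₀‖ ≤ 1`,
`‖y₀‖/100 ≤ Re⟨u₀, y₀⟩`) together with constants `C ≥ 0`, `β ∈ (0, 1]`, an angle modulus `G ≥ 0` with `G → 0⁺`,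
for which THE run from every start-quality state can always be continued
(`∀ s₀, Ctrl33 … s₀ → ClaimRun T x₀ Vy.S C β G (Ctrl33 …) s₀`).  NOT proved anywhere; incomparable with
`PartBResidual` (it asks the step only along the run, but asks the step to keep the (33)-control, as the text does,
v2 p.15).  [cite: Enflo2023, v2 p.5–6 (choice of `x₀, y₁'`), p.13 (26), p.15 (33), p.17 l.578–583, (40), (45), (46)] -/
@[claim "Enflo2023" "disputed"]
def PartBResidualRun : Prop :=
  ∀ (H : Type) [NormedAddCommGroup H] [InnerProductSpace ℂ H] [CompleteSpace H]
    [TopologicalSpace.SeparableSpace H], ¬ FiniteDimensional ℂ H →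
    ∀ (T : H →L[ℂ] H) (hT : ‖T‖ < 1), ‖T‖ = 1e-20 →
      HasNontrivialClosedInvariantSubspace T ∨
      ∃ (x₀ y₀ u₀ : H) (C β : ℝ) (G : ℝ → ℝ), ‖x₀‖ = 1
        ∧ (0.3 + 2.2 * (⟪x₀ - y₀, y₀⟫_ℂ).re ≤ ‖x₀ - y₀‖ ∧ ‖x₀ - y₀‖ ≤ 0.7) ∧ (⟪x₀ - y₀, y₀⟫_ℂ).im = 0
        ∧ 0 ≤ (⟪x₀ - y₀, y₀⟫_ℂ).re ∧ (⟪x₀ - y₀, y₀⟫_ℂ).re ≤ 1 / 10 ^ 4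
        ∧ (∀ m : ℕ, ‖⟪x₀ - y₀, (T ^ m) y₀⟫_ℂ‖ ≤ (⟪x₀ - y₀, y₀⟫_ℂ).re)
        ∧ ‖u₀‖ ≤ 1 ∧ ‖y₀‖ / 100 ≤ (⟪u₀, y₀⟫_ℂ).re
        ∧ 0 ≤ C ∧ 0 < β ∧ β ≤ 1 ∧ (∀ x, 0 ≤ G x)
        ∧ (∀ η : ℝ, 0 < η → ∃ δ : ℝ, 0 < δ ∧ ∀ x, 0 ≤ x → x ≤ δ → G x ≤ η)
        ∧ ∀ s₀ : State T x₀ Vy.S, Ctrl33 T hT u₀ (1.12 * (⟪x₀ - y₀, y₀⟫_ℂ).re) s₀ →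
            ClaimRun T x₀ Vy.S C β G (Ctrl33 T hT u₀ (1.12 * (⟪x₀ - y₀, y₀⟫_ℂ).re)) s₀

/-- **End to end, with Part A load-bearing.**  `Referee.ISP_separable` follows in the kernel from
`PartBResidualRun`: scale `T ≠ 0` to norm `10⁻²⁰` (`wlog_opNorm`), take Part A's exit state as the start
(`exists_ctrl33_of_partA`), run the endgame from the run-restricted residual (`MCStep.nis_of_claimRun`); `T = 0` has
an eigenline.  An IMPLICATION; its hypothesis is open. [cite: Enflo2023, v2 p.5, p.13 (26), pp.17–22] -/
theorem isp_of_partBResidualRun (hR : PartBResidualRun) : Referee.ISP_separable := by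
  intro H _ _ _ _ hH T
  by_cases hT0 : T = 0
  · rw [hT0]; exact nis_zero hH
  · obtain ⟨hnorm, hiff⟩ := wlog_opNorm T hT0
    set T' : H →L[ℂ] H := (((1e-20 : ℝ) / ‖T‖ : ℝ) : ℂ) • T
    have hT1 : ‖T'‖ < 1 := by rw [hnorm]; norm_num
    have hT20 : ‖T'‖ ≤ 1 / 10 ^ 20 := by rw [hnorm]; norm_num
    rcases hR H hH T' hT1 hnorm with hinv |
        ⟨x₀, y₀, u₀, C, β, G, hx₀, hwin, him, ht0, ht1, h9, hu₀, hA, hC, hβ, hβ1, hG0, hG, hclaim⟩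
    · exact hiff.1 hinv
    · exact hiff.1 (nis_of_partA_and_claimRun _ hT1 hT20 x₀ y₀ u₀ hx₀ hwin him ht0 ht1 h9 hu₀ hA hC hβ hβ1 G
        hG0 hG hclaim)

/-- **Part A ⟶ Part B from the weakest sufficient residual.**  Standing data at `y₁'` AND, for every start-quality
state `s₀`, SOME class of states containing `s₀` on which the restricted claim holds ("THE run from `s₀` can be
built": `∃ Good ∋ s₀, ClaimG T x₀ Vy.S C β G Good`) ⟹ a non-trivial closed invariant subspace.  A weaker hypothesis
than that of `nis_of_partA_and_claimRun` (`MCStep.exists_claimG_of_claimRun`); Part A still load-bearing (the class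
is asked for only at Part A's exit state).  An IMPLICATION; its residual hypothesis is open.
[cite: Enflo2023, v2 p.13 (26), p.15 (33), p.17 l.578–583, pp.18–20 (40)–(46), p.22 (11)] -/
theorem nis_of_partA_and_exists_claimG (T : H →L[ℂ] H) (hT : ‖T‖ < 1) (hT20 : ‖T‖ ≤ 1 / 10 ^ 20) (x₀ y₀ u₀ : H)
    (hx₀ : ‖x₀‖ = 1)
    (hwin : 0.3 + 2.2 * (⟪x₀ - y₀, y₀⟫_ℂ).re ≤ ‖x₀ - y₀‖ ∧ ‖x₀ - y₀‖ ≤ 0.7) (him : (⟪x₀ - y₀, y₀⟫_ℂ).im = 0)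
    (ht0 : 0 ≤ (⟪x₀ - y₀, y₀⟫_ℂ).re) (ht1 : (⟪x₀ - y₀, y₀⟫_ℂ).re ≤ 1 / 10 ^ 4)
    (h9 : ∀ m : ℕ, ‖⟪x₀ - y₀, (T ^ m) y₀⟫_ℂ‖ ≤ (⟪x₀ - y₀, y₀⟫_ℂ).re)
    (hu₀ : ‖u₀‖ ≤ 1) (hA : ‖y₀‖ / 100 ≤ (⟪u₀, y₀⟫_ℂ).re)
    {C β : ℝ} (hC : 0 ≤ C) (hβ : 0 < β) (hβ1 : β ≤ 1) (G : ℝ → ℝ) (hG0 : ∀ x, 0 ≤ G x)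
    (hG : ∀ η : ℝ, 0 < η → ∃ δ : ℝ, 0 < δ ∧ ∀ x, 0 ≤ x → x ≤ δ → G x ≤ η)
    (hclaim : ∀ s₀ : State T x₀ Vy.S, Ctrl33 T hT u₀ (1.12 * (⟪x₀ - y₀, y₀⟫_ℂ).re) s₀ →
      ∃ Good : State T x₀ Vy.S → Prop, Good s₀ ∧ ClaimG T x₀ Vy.S C β G Good) :
    HasNontrivialClosedInvariantSubspace T := by
  rcases exists_ctrl33_of_partA T hT hT20 x₀ y₀ u₀ hx₀ hwin him ht0 ht1 h9 hu₀ hA with hinv | ⟨s₀, hs₀⟩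
  · exact hinv
  · exact nis_of_exists_claimG T x₀ hx₀ Vy.S Vy.norm_S_le hC hβ hβ1 G hG0 hG (hclaim s₀ hs₀)

/-- **The weakest packaged Part-B residual** (companion of `PartBResidual`, `PartBResidualRun`): on every separable
infinite-dimensional Hilbert space, every operator of norm `10⁻²⁰` EITHER has a non-trivial closed invariant
subspace OR admits Part A's standing data at some `y₀ = y₁'` with constants `C ≥ 0`, `β ∈ (0, 1]`, a modulus
`G ≥ 0`, `G → 0⁺`, such that from every start-quality state SOME class of states containing it carries the
restricted claim (`∀ s₀, Ctrl33 … s₀ → ∃ Good ∋ s₀, ClaimG T x₀ Vy.S C β G Good`).  Implied by `PartBResidualRun`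
(`partBResidualClass_of_partBResidualRun`); NOT proved anywhere. [cite: Enflo2023, v2 p.5–6, p.13 (26), p.15 (33), p.17 l.578–583, (40), (45), (46)] -/
@[claim "Enflo2023" "disputed"]
def PartBResidualClass : Prop :=
  ∀ (H : Type) [NormedAddCommGroup H] [InnerProductSpace ℂ H] [CompleteSpace H]
    [TopologicalSpace.SeparableSpace H], ¬ FiniteDimensional ℂ H →
    ∀ (T : H →L[ℂ] H) (hT : ‖T‖ < 1), ‖T‖ = 1e-20 →
      HasNontrivialClosedInvariantSubspace T ∨
      ∃ (x₀ y₀ u₀ : H) (C β : ℝ) (G : ℝ → ℝ), ‖x₀‖ = 1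
        ∧ (0.3 + 2.2 * (⟪x₀ - y₀, y₀⟫_ℂ).re ≤ ‖x₀ - y₀‖ ∧ ‖x₀ - y₀‖ ≤ 0.7) ∧ (⟪x₀ - y₀, y₀⟫_ℂ).im = 0
        ∧ 0 ≤ (⟪x₀ - y₀, y₀⟫_ℂ).re ∧ (⟪x₀ - y₀, y₀⟫_ℂ).re ≤ 1 / 10 ^ 4
        ∧ (∀ m : ℕ, ‖⟪x₀ - y₀, (T ^ m) y₀⟫_ℂ‖ ≤ (⟪x₀ - y₀, y₀⟫_ℂ).re)
        ∧ ‖u₀‖ ≤ 1 ∧ ‖y₀‖ / 100 ≤ (⟪u₀, y₀⟫_ℂ).re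
        ∧ 0 ≤ C ∧ 0 < β ∧ β ≤ 1 ∧ (∀ x, 0 ≤ G x)
        ∧ (∀ η : ℝ, 0 < η → ∃ δ : ℝ, 0 < δ ∧ ∀ x, 0 ≤ x → x ≤ δ → G x ≤ η)
        ∧ ∀ s₀ : State T x₀ Vy.S, Ctrl33 T hT u₀ (1.12 * (⟪x₀ - y₀, y₀⟫_ℂ).re) s₀ →
            ∃ Good : State T x₀ Vy.S → Prop, Good s₀ ∧ ClaimG T x₀ Vy.S C β G Good

/-- `PartBResidualRun ⟹ PartBResidualClass` (the reachability class is such a class). [cite: Enflo2023, v2 p.17–20] -/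
theorem partBResidualClass_of_partBResidualRun (hR : PartBResidualRun) : PartBResidualClass := by
  intro H _ _ _ _ hH T hT hnorm
  rcases hR H hH T hT hnorm with hinv |
      ⟨x₀, y₀, u₀, C, β, G, hx₀, hwin, him, ht0, ht1, h9, hu₀, hA, hC, hβ, hβ1, hG0, hG, hclaim⟩
  · exact Or.inl hinv
  · exact Or.inr ⟨x₀, y₀, u₀, C, β, G, hx₀, hwin, him, ht0, ht1, h9, hu₀, hA, hC, hβ, hβ1, hG0, hG,
      fun s₀ hs₀ => exists_claimG_of_claimRun (hclaim s₀ hs₀)⟩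

/-- **End to end from the weakest packaged residual**: `PartBResidualClass → Referee.ISP_separable`.
An IMPLICATION; its hypothesis is open. [cite: Enflo2023, v2 p.5, p.13 (26), pp.17–22] -/
theorem isp_of_partBResidualClass (hR : PartBResidualClass) : Referee.ISP_separable := by
  intro H _ _ _ _ hH T
  by_cases hT0 : T = 0
  · rw [hT0]; exact nis_zero hH
  · obtain ⟨hnorm, hiff⟩ := wlog_opNorm T hT0
    set T' : H →L[ℂ] H := (((1e-20 : ℝ) / ‖T‖ : ℝ) : ℂ) • T
    have hT1 : ‖T'‖ < 1 := by rw [hnorm]; norm_num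
    have hT20 : ‖T'‖ ≤ 1 / 10 ^ 20 := by rw [hnorm]; norm_num
    rcases hR H hH T' hT1 hnorm with hinv |
        ⟨x₀, y₀, u₀, C, β, G, hx₀, hwin, him, ht0, ht1, h9, hu₀, hA, hC, hβ, hβ1, hG0, hG, hclaim⟩
    · exact hiff.1 hinv
    · exact hiff.1 (nis_of_partA_and_exists_claimG _ hT1 hT20 x₀ y₀ u₀ hx₀ hwin him ht0 ht1 h9 hu₀ hA hC hβ
        hβ1 G hG0 hG hclaim)

end EndToEnd

/-! ### Calibration of the run-restricted residual (the two audits of `ClaimAudit`, carried over) -/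

namespace MCStep

variable {H : Type*} [NormedAddCommGroup H] [InnerProductSpace ℂ H] [CompleteSpace H]

/-- **(B') The hard-window artefact, run-restricted.**  For every `T` with `‖T‖ < 1`, unit `x₀`, `β > 0`, `G` and
`C < 1`: from the SELF-PIVOT start (the minimal move of `y = x₀` at radius `0.7`) the run cannot even begin —
`ClaimRun T x₀ Vy.S C β G N P` is false for EVERY invariant `N` — since a step must keep `‖v‖ ≤ 0.7` and by
`Re⟨v, x₀⟩ = ‖v‖² + (εθ)` its drift is `≤ −β(εθ)_P < −Cβ(εθ)_P`.  So the invariant-free residual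
`∀ s₀, ClaimRun … ⊤ s₀` needs `C ≥ 1` exactly as `Claim` does (`ClaimAudit.not_claim_of_C_lt_one`); the (33)-started
residual of `EndToEnd.nis_of_partA_and_claimRun` is not touched by this witness (its start radius is Part A's exit
radius).  Bounds the cell's typing, not the text (`C = 10` there). [cite: Enflo2023, v2 (16) p.6, (45) p.19, p.5 l.152] -/
theorem not_claimRun_self_of_C_lt_one (T : H →L[ℂ] H) (hT : ‖T‖ < 1) (x₀ : H) (hx₀ : ‖x₀‖ = 1)
    {C β : ℝ} (hC : C < 1) (hβ : 0 < β) (G : ℝ → ℝ) :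
    ∃ P : State T x₀ Vy.S, P.V = Vy.V T hT x₀ ∧ P.ε = 0.7 ∧
      ∀ N : State T x₀ Vy.S → Prop, ¬ ClaimRun T x₀ Vy.S C β G N P := by
  obtain ⟨P, hPV, hPε⟩ := exists_state_self T hT x₀
  refine ⟨P, hPV, hPε, fun N hclaim => ?_⟩
  have hpos : 0 < P.etheta := etheta_pos_of_self T hT x₀ hx₀ P hPV
  obtain ⟨c, -, -, hstep⟩ := hclaim P ReachN.start
  obtain ⟨s', -, h1, -, h3⟩ := hstep P ReachN.start (invP_self' C P c)
  have eP := P.re_inner_x₀_v hx₀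
  have es := s'.re_inner_x₀_v hx₀
  have nP : ‖P.v‖ = 0.7 := by rw [P.norm_v hx₀, hPε]
  have ns : ‖s'.v‖ ≤ 0.7 := by rw [s'.norm_v hx₀]; exact s'.hε.2
  have ns2 : ‖s'.v‖ ^ 2 ≤ 0.7 ^ 2 := pow_le_pow_left₀ (norm_nonneg _) ns 2
  have hd : -(C * β * P.etheta) ≤ re ⟪x₀, s'.v - P.v⟫_ℂ := (abs_le.mp h3).1
  rw [inner_sub_right, map_sub, RCLike.re_to_complex, RCLike.re_to_complex, es, eP, nP] at hd
  nlinarith [mul_pos (mul_pos hβ hpos) (sub_pos.mpr hC)]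

/-- **(C') Consistency of the typing, run-restricted.**  On an infinite-dimensional space the zero operator
satisfies the invariant-free run-restricted residual from EVERY start state, with `C = 1`, any `β ∈ [0, 1]` and
`G(E) = 200|E|` (from `ClaimAudit.claim_zero` by `claimRun_top_of_claim`) — satisfiable by an operator WITH
invariant subspaces; consistency only. [cite: Enflo2023, v2 p.17–20, (40), (45), (46)] -/
theorem claimRun_top_zero (hH : ¬ FiniteDimensional ℂ H) (x₀ : H) (hx₀ : ‖x₀‖ = 1) {β : ℝ} (hβ0 : 0 ≤ β)
    (hβ1 : β ≤ 1) (s₀ : State (0 : H →L[ℂ] H) x₀ Vy.S) :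
    ClaimRun (0 : H →L[ℂ] H) x₀ Vy.S 1 β (fun E => 200 * |E|) (fun _ => True) s₀ :=
  claimRun_top_of_claim (claim_zero hH x₀ hx₀ hβ0 hβ1) s₀

end MCStep

end Literature.Analysis.OperatorTheory.Enflo2023

end
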